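import Literature.Geometry.Kaehler.CechDeRham
import Literature.NumberTheory.Transcendental.ComplexFormsProofs
import HarnessLib

/-!
# The cohomology of the complex `(Ω•(W), d_W)` of local forms: canonical comparison maps

[topic Geometry/Kaehler]

Companion to `Geometry/Kaehler/LocalForms` and `Geometry/Kaehler/CechDeRham`. The Čech–de Rham
machinery of the tree (`cechDeRhamRow`, `ADoubleComplex.RowAugmentation.totMap`,
[BottTu1982Forms, §8 Prop. 8.8]) computes the cohomology of the complex of local forms
`(smoothFormsOn I F W •, localD)` in the sense of `NatCochain.Cohomology` (cocycles modulo
coboundaries of an `ℕ`-indexed complex, `Algebra/Homology/DoubleComplexExactRows`), whereas the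
rest of the forms library speaks of `LocalDeRham I F n hW` (closed local forms modulo exact ones),
of the global de Rham cohomology `deRhamCohomology I M F n` of `ManifoldForms`, and — for
`ℂ`-valued forms on a manifold modelled on a complex vector space — of the complex de Rham
cohomology `complexDeRhamCohomology E M n` of `NumberTheory/Transcendental/ComplexForms`
(a `ℂ`-vector space). `CechDeRham` records only the EXISTENCE of identifications
(`nonempty_localDeRham_equiv_cohomology`). This file gives the CANONICAL maps, all the identity on
representatives, as explicit linear equivalences:

* `localCohomologyToLocalDeRham hW n : Hⁿ(Ω•(W), d_W) →ₗ[ℝ] LocalDeRham I F n hW`, bijective,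
  `localCohomologyEquivLocalDeRham`;
* `localCohomologyEquivDeRham n : Hⁿ(Ω•(M), d) ≃ₗ[ℝ] deRhamCohomology I M F n` (`W = univ`,
  through the tree's `LocalDeRham.equivDeRhamCohomology`);
* `deRhamCohomology.toComplex k : deRhamCohomology 𝓘(ℝ, E) M ℂ k →ₗ[ℝ] complexDeRhamCohomology E M k`,
  bijective (`mem_cclosedSmoothForms_iff`, `complexDeRhamCohomology.mk_eq_mk_iff_mem_exactSmoothForms`
  of `ComplexFormsProofs`: the `ℂ`-spans add nothing), `deRhamCohomology.equivComplex`;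
* `localCohomologyEquivComplexDeRham n : Hⁿ(Ω•(M; ℂ), d) ≃ₗ[ℝ] complexDeRhamCohomology E M n` and
  its value on the class of a cocycle (`localCohomologyEquivComplexDeRham_mk`).

[Warner1983, 4.11 / 5.28: de Rham cohomology as closed modulo exact forms; BottTu1982Forms, §I.1,
§8.] Everything is proved; the only definitions are the comparison maps; no named facts.

## References

* [BottTu1982Forms] R. Bott, L. W. Tu, *Differential Forms in Algebraic Topology*, §I.1, §8 Prop. 8.8.
* [Warner1983] F. Warner, *Foundations of Differentiable Manifolds and Lie Groups*, 4.11, 5.28.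
* [WellsDACM1980] R. O. Wells, *Differential Analysis on Complex Manifolds*, Ch. II §1.
-/

noncomputable section

open scoped Manifold ContDiff Topology
open Set Literature.Algebra.Homology

namespace Literature.Geometry.Kaehler

section Real

variable {E : Type*} [NormedAddCommGroup E] [NormedSpace ℝ E]
  {H : Type*} [TopologicalSpace H] {I : ModelWithCorners ℝ E H}
  {M : Type*} [TopologicalSpace M] [ChartedSpace H M] [IsManifold I ∞ M]
  {F : Type*} [NormedAddCommGroup F] [NormedSpace ℝ F]

/-! ### `Hⁿ(Ω•(W), d_W)` versus `LocalDeRham` -/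

variable (I F) in
/-- A cocycle of `(Ω•(W), d_W)` is a closed form on `W`. [cite: BottTu1982Forms, §I.1] -/
def localCocyclesToClosed {W : Set M} (hW : IsOpen W) (n : ℕ) :
    ↥(NatCochain.cocycles (fun q ↦ localD I F q hW) n) →ₗ[ℝ] ↥(localClosedForms I F n W) where
  toFun z := ⟨((z : smoothFormsOn I F W n) : MForm I M F n),
    (mem_localClosedForms_iff_localD_eq_zero hW (z : smoothFormsOn I F W n)).2
      ((NatCochain.mem_cocycles_iff _).1 z.2)⟩
  map_add' _ _ := rfl
  map_smul' _ _ := rfl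

/-- Underlying form of `localCocyclesToClosed`. [cite: BottTu1982Forms, §I.1] -/
@[simp]
theorem coe_localCocyclesToClosed {W : Set M} (hW : IsOpen W) (n : ℕ)
    (z : NatCochain.cocycles (fun q ↦ localD I F q hW) n) :
    (localCocyclesToClosed I F hW n z : MForm I M F n) = ((z : smoothFormsOn I F W n) : MForm I M F n) :=
  rfl

omit [IsManifold I ∞ M] in
/-- A coboundary of `(Ω•(W), d_W)` is an exact form on `W`, and conversely. [cite: BottTu1982Forms, §I.1] -/
theorem mem_coboundaries_localD_iff [IsManifold I ∞ M] {W : Set M} (hW : IsOpen W) {n : ℕ}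
    (z : smoothFormsOn I F W n) :
    z ∈ NatCochain.coboundaries (fun q ↦ localD I F q hW) n ↔
      (z : MForm I M F n) ∈ localExactForms I F hW n := by
  cases n with
  | zero =>
    rw [NatCochain.coboundaries_zero, Submodule.mem_bot, localExactForms, Submodule.mem_bot,
      ZeroMemClass.coe_eq_zero]
  | succ n =>
    rw [NatCochain.mem_coboundaries_succ_iff, mem_localExactForms_succ_iff]
    constructor
    · rintro ⟨γ, hγ⟩
      exact ⟨γ, congrArg Subtype.val hγ⟩
    · rintro ⟨γ, hγ⟩
      exact ⟨γ, Subtype.ext hγ⟩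

variable (I F) in
/-- **The canonical map `Hⁿ(Ω•(W), d_W) → H^n_dR(W)`** from the cohomology of the complex of local
forms to the local de Rham cohomology (identity on representatives). [cite: BottTu1982Forms, §I.1] -/
def localCohomologyToLocalDeRham {W : Set M} (hW : IsOpen W) (n : ℕ) :
    NatCochain.Cohomology (fun q ↦ localD I F q hW) n →ₗ[ℝ] LocalDeRham I F n hW :=
  Submodule.mapQ _ _ (localCocyclesToClosed I F hW n) fun z hz ↦
    (mem_coboundaries_localD_iff hW (z : smoothFormsOn I F W n)).1 hz

/-- The canonical map on the class of a cocycle (identity on representatives). [cite: BottTu1982Forms, §I.1] -/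
theorem localCohomologyToLocalDeRham_mk {W : Set M} (hW : IsOpen W) (n : ℕ)
    (z : NatCochain.cocycles (fun q ↦ localD I F q hW) n) :
    localCohomologyToLocalDeRham I F hW n (NatCochain.Cohomology.mk _ n z) =
      LocalDeRham.mk hW (localCocyclesToClosed I F hW n z) :=
  rfl

/-- **`Hⁿ(Ω•(W), d_W) → H^n_dR(W)` is bijective.** [cite: BottTu1982Forms, §I.1] -/
theorem localCohomologyToLocalDeRham_bijective {W : Set M} (hW : IsOpen W) (n : ℕ) :
    Function.Bijective (localCohomologyToLocalDeRham I F hW n) := by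
  constructor
  · rw [injective_iff_map_eq_zero]
    intro c hc
    obtain ⟨z, rfl⟩ := NatCochain.Cohomology.mk_surjective _ n c
    rw [localCohomologyToLocalDeRham_mk, LocalDeRham.mk_eq_zero_iff, coe_localCocyclesToClosed,
      ← mem_coboundaries_localD_iff hW] at hc
    exact (NatCochain.Cohomology.mk_eq_zero_iff (fun q ↦ localD I F q hW) z).2 hc
  · intro c
    obtain ⟨α, rfl⟩ := LocalDeRham.mk_surjective hW c
    refine ⟨NatCochain.Cohomology.mk _ n ⟨⟨(α : MForm I M F n), α.2.1⟩,
      (NatCochain.mem_cocycles_iff _).2 ((mem_localClosedForms_iff_localD_eq_zero hW _).1 α.2)⟩, ?_⟩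
    rw [localCohomologyToLocalDeRham_mk]
    rfl

variable (I F) in
/-- `Hⁿ(Ω•(W), d_W) ≃ H^n_dR(W)` as a linear equivalence. [cite: BottTu1982Forms, §I.1] -/
def localCohomologyEquivLocalDeRham {W : Set M} (hW : IsOpen W) (n : ℕ) :
    NatCochain.Cohomology (fun q ↦ localD I F q hW) n ≃ₗ[ℝ] LocalDeRham I F n hW :=
  LinearEquiv.ofBijective _ (localCohomologyToLocalDeRham_bijective hW n)

/-- The equivalence on the class of a cocycle (identity on representatives). [cite: BottTu1982Forms, §I.1] -/
theorem localCohomologyEquivLocalDeRham_mk {W : Set M} (hW : IsOpen W) (n : ℕ)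
    (z : NatCochain.cocycles (fun q ↦ localD I F q hW) n) :
    localCohomologyEquivLocalDeRham I F hW n (NatCochain.Cohomology.mk _ n z) =
      LocalDeRham.mk hW (localCocyclesToClosed I F hW n z) :=
  rfl

/-! ### `W = univ`: `Hⁿ(Ω•(M), d)` versus the de Rham cohomology of `ManifoldForms` -/

variable (I F) in
/-- **`Hⁿ(Ω•(M), d) ≃ H^n_dR(M)`**: the cohomology of the complex of forms on `univ` (the row
augmentation `cechDeRhamRow` of the Čech–de Rham complex) is the de Rham cohomology of
`ManifoldForms`, canonically (identity on representatives). [cite: BottTu1982Forms, §8 Prop. 8.8] -/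
def localCohomologyEquivDeRham (n : ℕ) :
    NatCochain.Cohomology (fun q ↦ localD I F q (isOpen_univ : IsOpen (univ : Set M))) n ≃ₗ[ℝ]
      deRhamCohomology I M F n :=
  (localCohomologyEquivLocalDeRham I F isOpen_univ n).trans (LocalDeRham.equivDeRhamCohomology n)

/-- The equivalence on the class of a cocycle: the de Rham class of the underlying (closed smooth)
form (any membership witness). [cite: Warner1983, 4.11] -/
theorem localCohomologyEquivDeRham_mk (n : ℕ)
    (z : NatCochain.cocycles (fun q ↦ localD I F q (isOpen_univ : IsOpen (univ : Set M))) n)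
    (h : ((z : smoothFormsOn I F (univ : Set M) n) : MForm I M F n) ∈ closedSmoothForms I M F n) :
    localCohomologyEquivDeRham I F n (NatCochain.Cohomology.mk _ n z) = deRhamCohomology.mk ⟨_, h⟩ := by
  rw [localCohomologyEquivDeRham, LinearEquiv.trans_apply, localCohomologyEquivLocalDeRham_mk,
    LocalDeRham.equivDeRhamCohomology, LinearEquiv.ofBijective_apply]
  rfl

end Real

/-! ### Complex coefficients: `H^k_dR(M; ℂ)` of `ManifoldForms` versus `complexDeRhamCohomology` -/

section Complex

open Literature.NumberTheory.Transcendental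

variable {E : Type*} [NormedAddCommGroup E] [NormedSpace ℂ E]
  {M : Type*} [TopologicalSpace M] [ChartedSpace E M] [IsManifold 𝓘(ℝ, E) ∞ M]

/-- A closed smooth `ℂ`-valued form is a member of the `ℂ`-span `Z^k(M; ℂ)`
(`mem_cclosedSmoothForms_iff`). [cite: WellsDACM1980, Ch. II §1] -/
def closedToCclosed (k : ℕ) :
    ↥(closedSmoothForms 𝓘(ℝ, E) M ℂ k) →ₗ[ℝ] ↥(cclosedSmoothForms E M k) where
  toFun β := ⟨(β : MForm 𝓘(ℝ, E) M ℂ k), (mem_cclosedSmoothForms_iff _).2 β.2⟩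
  map_add' _ _ := rfl
  map_smul' _ _ := rfl

omit [IsManifold 𝓘(ℝ, E) ∞ M] in
/-- Underlying form of `closedToCclosed`. [cite: WellsDACM1980, Ch. II §1] -/
@[simp]
theorem coe_closedToCclosed (k : ℕ) (β : closedSmoothForms 𝓘(ℝ, E) M ℂ k) :
    (closedToCclosed k β : MForm 𝓘(ℝ, E) M ℂ k) = β :=
  rfl

/-- **The canonical map `H^k_dR(M; ℂ) → complexDeRhamCohomology`** (identity on representatives),
from the `ℝ`-module of `ManifoldForms` to the `ℂ`-vector space of `ComplexForms`.
[cite: WellsDACM1980, Ch. II §1] -/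
def deRhamCohomology.toComplex (k : ℕ) :
    deRhamCohomology 𝓘(ℝ, E) M ℂ k →ₗ[ℝ] complexDeRhamCohomology E M k :=
  (Submodule.Quotient.restrictScalarsEquiv ℝ
      ((cexactSmoothForms E M k).comap (cclosedSmoothForms E M k).subtype)).toLinearMap ∘ₗ
    Submodule.mapQ _
      (((cexactSmoothForms E M k).comap (cclosedSmoothForms E M k).subtype).restrictScalars ℝ)
      (closedToCclosed k) fun β hβ ↦ by
        change (β : MForm 𝓘(ℝ, E) M ℂ k) ∈ exactSmoothForms 𝓘(ℝ, E) M ℂ k at hβ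
        change (β : MForm 𝓘(ℝ, E) M ℂ k) ∈ cexactSmoothForms E M k
        rw [← Submodule.restrictScalars_mem ℝ, restrictScalars_cexactSmoothForms_holds k]
        exact hβ

omit [IsManifold 𝓘(ℝ, E) ∞ M] in
/-- The canonical map on the class of a closed form (identity on representatives). [cite: WellsDACM1980, Ch. II §1] -/
theorem deRhamCohomology.toComplex_mk (k : ℕ) (β : closedSmoothForms 𝓘(ℝ, E) M ℂ k) :
    deRhamCohomology.toComplex k (deRhamCohomology.mk β) =
      complexDeRhamCohomology.mk E M k (closedToCclosed k β) :=
  rfl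

omit [IsManifold 𝓘(ℝ, E) ∞ M] in
/-- **`H^k_dR(M; ℂ) → complexDeRhamCohomology` is bijective** (same closed forms, and the exact
`ℂ`-span is the real module of exact forms). [cite: WellsDACM1980, Ch. II §1] -/
theorem deRhamCohomology.toComplex_bijective (k : ℕ) :
    Function.Bijective (deRhamCohomology.toComplex (E := E) (M := M) k) := by
  constructor
  · rw [injective_iff_map_eq_zero]
    intro c hc
    obtain ⟨β, rfl⟩ := deRhamCohomology.mk_surjective c
    rw [deRhamCohomology.toComplex_mk, ← map_zero (complexDeRhamCohomology.mk E M k),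
      complexDeRhamCohomology.mk_eq_mk_iff_mem_exactSmoothForms, coe_closedToCclosed,
      ZeroMemClass.coe_zero, sub_zero] at hc
    rw [← map_zero deRhamCohomology.mk, deRhamCohomology.mk_eq_mk_iff, ZeroMemClass.coe_zero,
      sub_zero]
    exact hc
  · intro c
    obtain ⟨α, rfl⟩ := complexDeRhamCohomology.mk_surjective c
    exact ⟨deRhamCohomology.mk ⟨(α : MForm 𝓘(ℝ, E) M ℂ k), (mem_cclosedSmoothForms_iff _).1 α.2⟩, rfl⟩

/-- `H^k_dR(M; ℂ) ≃ complexDeRhamCohomology E M k` as an `ℝ`-linear equivalence.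
[cite: WellsDACM1980, Ch. II §1] -/
def deRhamCohomology.equivComplex (k : ℕ) :
    deRhamCohomology 𝓘(ℝ, E) M ℂ k ≃ₗ[ℝ] complexDeRhamCohomology E M k :=
  LinearEquiv.ofBijective _ (deRhamCohomology.toComplex_bijective k)

omit [IsManifold 𝓘(ℝ, E) ∞ M] in
/-- The equivalence on the class of a closed form (identity on representatives). [cite: WellsDACM1980, Ch. II §1] -/
theorem deRhamCohomology.equivComplex_mk (k : ℕ) (β : closedSmoothForms 𝓘(ℝ, E) M ℂ k) :
    deRhamCohomology.equivComplex k (deRhamCohomology.mk β) =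
      complexDeRhamCohomology.mk E M k (closedToCclosed k β) :=
  rfl

/-- **`Hⁿ(Ω•(M; ℂ), d) ≃ complexDeRhamCohomology E M n`**: the cohomology of the complex of
`ℂ`-valued forms on `univ` (as computed by the Čech–de Rham edge map) is the complex de Rham
cohomology, canonically. [cite: BottTu1982Forms, §8 Prop. 8.8] [cite: WellsDACM1980, Ch. II §1] -/
def localCohomologyEquivComplexDeRham (n : ℕ) :
    NatCochain.Cohomology (fun q ↦ localD 𝓘(ℝ, E) ℂ q (isOpen_univ : IsOpen (univ : Set M))) n ≃ₗ[ℝ]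
      complexDeRhamCohomology E M n :=
  (localCohomologyEquivDeRham 𝓘(ℝ, E) ℂ n).trans (deRhamCohomology.equivComplex n)

/-- The equivalence on the class of a cocycle: the complex de Rham class of the underlying form
(any membership witness). [cite: WellsDACM1980, Ch. II §1] -/
theorem localCohomologyEquivComplexDeRham_mk (n : ℕ)
    (z : NatCochain.cocycles (fun q ↦ localD 𝓘(ℝ, E) ℂ q (isOpen_univ : IsOpen (univ : Set M))) n)
    (h : ((z : smoothFormsOn 𝓘(ℝ, E) ℂ (univ : Set M) n) : MForm 𝓘(ℝ, E) M ℂ n) ∈ cclosedSmoothForms E M n) :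
    localCohomologyEquivComplexDeRham n (NatCochain.Cohomology.mk _ n z) =
      complexDeRhamCohomology.mk E M n ⟨_, h⟩ := by
  rw [localCohomologyEquivComplexDeRham, LinearEquiv.trans_apply,
    localCohomologyEquivDeRham_mk n z ((mem_cclosedSmoothForms_iff _).1 h),
    deRhamCohomology.equivComplex, LinearEquiv.ofBijective_apply, deRhamCohomology.toComplex_mk]
  rfl

end Complex

end Literature.Geometry.Kaehler

end
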